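import Literature.NumberTheory.EllipticCurves.GreenbergVatsal2000.NonPrimitiveSelmerGroup
import Literature.NumberTheory.EllipticCurves.IwasawaSelmerDualProofs
import HarnessLib

/-!
# The `Λ`-module `X^{Σ₀} = Hom(Sel^{Σ₀}_E(K_∞)_p, ℚ/ℤ)` EXISTS: the Pontryagin dual of
# Greenberg–Vatsal's non-primitive Selmer group is a `NonPrimitiveDualData`

HONEST FRAMING (BSD rank-`≤ 1` residual cell `b2b-bsdres`, home
`run/shared/lean/b2b/bsd-rank1-residual/`, unit `b2b-bsdres-eisenstein-p2`, class X2; research route,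
no claim beyond stated classes): the cell deletes the COMBINATION-SHAPED residual classes of the
rank-`≤ 1` BSD formula from PUBLISHED theorems only and TYPES the construction-shaped ones; this is
not "finishing BSD". Definitions WITH BODIES and theorems (no named fact, nothing asserted): for any
number field `K`, any `ℤ_p`-extension `κ`, a topological generator `γ` and any set `Σ₀` of finite
places, the character group `Hom(Sel^{Σ₀}_E(K_∞)_p, ℚ/ℤ)` of Greenberg–Vatsal's non-primitive Selmer
group (`Literature/…/GreenbergVatsal2000/NonPrimitiveSelmerGroup.lean`, `nonPrimitiveSelmerInfty`)
with its `Λ = ℤ_p⟦T⟧`-structure (`T = γ - 1`, the tree's `IwasawaDual.IsLocNil.module`) IS a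
`GreenbergVatsal2000.NonPrimitiveDualData` — VERBATIM the tree's construction
`WeierstrassCurve.selmerDualData` / `nonempty_selmerDualData_holds` (`IwasawaSelmerDualProofs`) with
`Sel` replaced by `Sel^{Σ₀}`:

* `conjNonPrimitive γ` — `conj_γ` as an endomorphism of `Sel^{Σ₀}` (conj-stability is the Literature
  theorem `conjH1_mem_nonPrimitiveSelmerInfty`); `coe_conjNonPrimitive_pow_apply`;
* `isLocNil_conjNonPrimitive_sub_one` — `Sel^{Σ₀}` is `p`-primary and `γ - 1` is locally nilpotent;
* **`nonPrimitiveDualData`**, **`nonempty_nonPrimitiveDualData`** — the datum and its existence;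
* `toDualEquiv` — any datum's `toDual` as an `AddEquiv D.X ≃+ Hom(Sel^{Σ₀}, ℚ/ℤ)` (the input shape
  of `X2/NonPrimitiveSelmerTorsionCard`).

Step 1 of the kernel derivation of route G's typed input `X1.CongruenceTransfer.CongruentLambdaShift`
(`X2/CongruentLambdaShiftDerived.lean`).

References: R. Greenberg, V. Vatsal, Invent. Math. 142 (2000), §1 p. 7, §2 p. 17; R. Greenberg,
LNM 1716 (1999), §1 p. 60 ("`H¹(F_∞, E[p^∞])` … is a `Λ`-module").
-/

noncomputable section

open scoped Classical

universe u

namespace Summit.BirchSwinnertonDyer.Rank1Residual.X2.NonPrimitiveSelmerDual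

open NumberField IsDedekindDomain Field Literature.NumberTheory.EllipticCurves
  Literature.NumberTheory.EllipticCurves.GreenbergVatsal2000

/-! ## The `Λ`-module `Hom(Sel^{Σ₀}_E(K_∞)_p, ℚ/ℤ)` is a `NonPrimitiveDualData` -/

section Dual

variable {K : Type u} [Field K] [NumberField K] (W : WeierstrassCurve K) {p : ℕ} [Fact p.Prime]
  (κ : ZpExtension K p) (S₀ : Set (HeightOneSpectrum (𝓞 K)))

/-- `conj_γ` restricted to an endomorphism of `Sel^{Σ₀}_E(K_∞)_p` (it preserves the group by
`conjH1_mem_nonPrimitiveSelmerInfty`) — as `WeierstrassCurve.conjSelmerInfty`.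
[cite: GreenbergVatsal2000, §2 p. 17] -/
def conjNonPrimitive (γ : absoluteGaloisGroup K) :
    AddMonoid.End (nonPrimitiveSelmerInfty W κ S₀) :=
  ((W.conjH1 p κ.kerSubgroup γ).restrict (nonPrimitiveSelmerInfty W κ S₀)).codRestrict
    (nonPrimitiveSelmerInfty W κ S₀) fun s ↦ conjH1_mem_nonPrimitiveSelmerInfty W κ S₀ γ s.2

/-- Unfolding `conjNonPrimitive` (definitional). [folklore] -/
@[simp]
theorem coe_conjNonPrimitive_apply (γ : absoluteGaloisGroup K) (s : nonPrimitiveSelmerInfty W κ S₀) :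
    ((conjNonPrimitive W κ S₀ γ s : nonPrimitiveSelmerInfty W κ S₀) :
        W.subgroupH1 p κ.kerSubgroup) = W.conjH1 p κ.kerSubgroup γ s :=
  rfl

/-- Powers: `(conjNonPrimitive γ)^m = conj_{γ^m}` on `Sel^{Σ₀}` (`conjH1_one`, `conjH1_mul`).
[folklore] -/
theorem coe_conjNonPrimitive_pow_apply (γ : absoluteGaloisGroup K) (m : ℕ)
    (s : nonPrimitiveSelmerInfty W κ S₀) :
    ((((conjNonPrimitive W κ S₀ γ) ^ m) s : nonPrimitiveSelmerInfty W κ S₀) :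
        W.subgroupH1 p κ.kerSubgroup) = W.conjH1 p κ.kerSubgroup (γ ^ m) s := by
  induction m generalizing s with
  | zero => rw [pow_zero, pow_zero, AddMonoid.End.one_apply, W.conjH1_one_holds p κ.kerSubgroup,
      AddMonoidHom.id_apply]
  | succ m ih =>
    rw [pow_succ, AddMonoid.End.coe_mul, Function.comp_apply, ih, coe_conjNonPrimitive_apply,
      pow_succ, W.conjH1_mul_holds p κ.kerSubgroup, AddMonoidHom.comp_apply]

/-- **`Sel^{Σ₀}_E(K_∞)_p` is `p`-primary and `T = γ - 1` is locally nilpotent on it**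
(`IwasawaDual.IsLocNil`), for `γ` a topological generator: every class of `H¹(K_∞, E[p^∞])` is
killed by a power of `p` (`exists_pow_smul_subgroupH1_ker_eq_zero`) and fixed by `conj_{γ^{p^a}}`
(`exists_conjH1_pow_prime_pow_eq`), whence `(conj_γ - 1)^{k p^a} s = 0`
(`IwasawaDual.pow_mul_prime_pow_apply_eq_zero`) — as
`WeierstrassCurve.isLocNil_conjSelmerInfty_sub_one`. [cite: GreenbergLNM1716, §1 p. 60] -/
theorem isLocNil_conjNonPrimitive_sub_one {γ : absoluteGaloisGroup K} (hγ : κ.IsTopGenerator γ) :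
    IwasawaDual.IsLocNil p (conjNonPrimitive W κ S₀ γ - 1) := by
  have htor : ∀ s : nonPrimitiveSelmerInfty W κ S₀, ∃ k : ℕ, p ^ k • s = 0 := fun s ↦ by
    obtain ⟨k, hk⟩ := W.exists_pow_smul_subgroupH1_ker_eq_zero κ (s : W.subgroupH1 p κ.kerSubgroup)
    exact ⟨k, Subtype.ext (by rw [AddSubgroupClass.coe_nsmul]; exact hk)⟩
  refine ⟨htor, fun s ↦ ?_⟩
  obtain ⟨a, ha⟩ := W.exists_conjH1_pow_prime_pow_eq κ hγ (s : W.subgroupH1 p κ.kerSubgroup)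
  obtain ⟨k, hk⟩ := htor s
  have hφ : ((conjNonPrimitive W κ S₀ γ) ^ p ^ a) s = s :=
    Subtype.ext (by rw [coe_conjNonPrimitive_pow_apply]; exact ha)
  exact ⟨k * p ^ a, IwasawaDual.pow_mul_prime_pow_apply_eq_zero (Fact.out : p.Prime) _ a hφ hk⟩

/-- **The Iwasawa module `X^{Σ₀} = Hom(Sel^{Σ₀}_E(K_∞)_p, ℚ/ℤ)` with its `Λ`-structure IS a
`NonPrimitiveDualData`** (`T = γ - 1`, constants through `ℤ_p → ℤ/p^k`; `toDual = id`; the module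
structure is `IwasawaDual.IsLocNil.module` of the tree's `IwasawaDualModule`) — the construction
`WeierstrassCurve.selmerDualData` with `Sel` replaced by `Sel^{Σ₀}`.
[cite: GreenbergVatsal2000, §1 p. 7 and §2 p. 17] [cite: GreenbergLNM1716, §1 p. 60] -/
def nonPrimitiveDualData {γ : absoluteGaloisGroup K} (hγ : κ.IsTopGenerator γ) :
    NonPrimitiveDualData W κ γ S₀ :=
  { X := nonPrimitiveSelmerInfty W κ S₀ →+ AddCircle (1 : ℚ)
    module := (isLocNil_conjNonPrimitive_sub_one W κ S₀ hγ).module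
    conj_mem := fun s hs ↦ conjH1_mem_nonPrimitiveSelmerInfty W κ S₀ γ hs
    toDual := AddMonoidHom.id _
    bijective := Function.bijective_id
    toDual_T_smul := fun x s ↦ by
      show (isLocNil_conjNonPrimitive_sub_one W κ S₀ hγ).smulFun PowerSeries.X x s = x _ - x s
      rw [(isLocNil_conjNonPrimitive_sub_one W κ S₀ hγ).smulFun_X_apply, IwasawaDual.End_sub_apply,
        AddMonoid.End.one_apply, map_sub]
      rfl
    toDual_C_smul := fun c x s k hk ↦ by
      show (isLocNil_conjNonPrimitive_sub_one W κ S₀ hγ).smulFun (PowerSeries.C c) x s = _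
      exact (isLocNil_conjNonPrimitive_sub_one W κ S₀ hγ).smulFun_C_apply c x hk }

/-- **Existence**: for `γ` a topological generator of `Gal(K_∞/K)`, Pontryagin-dual data for the
non-primitive Selmer group exist (`nonPrimitiveDualData`). [cite: GreenbergLNM1716, §1 p. 60] -/
theorem nonempty_nonPrimitiveDualData {γ : absoluteGaloisGroup K} (hγ : κ.IsTopGenerator γ) :
    Nonempty (NonPrimitiveDualData W κ γ S₀) :=
  ⟨nonPrimitiveDualData W κ S₀ hγ⟩

/-- **Any dual datum is, as a group, the character group of `Sel^{Σ₀}`**: the `AddEquiv` packaged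
from the fields `toDual`/`bijective`, the input shape of
`NonPrimitiveSelmerTorsionCard.finite_and_natCard_torsionBy_eq_pow_lambdaInvariant_of_divisible`.
[folklore] -/
def toDualEquiv {γ : absoluteGaloisGroup K} (D : NonPrimitiveDualData W κ γ S₀) :
    D.X ≃+ CharacterModule (nonPrimitiveSelmerInfty W κ S₀) :=
  AddEquiv.ofBijective D.toDual D.bijective

/-- `toDualEquiv` is `toDual` (definitional). [folklore] -/
theorem toDualEquiv_apply {γ : absoluteGaloisGroup K} (D : NonPrimitiveDualData W κ γ S₀) (x : D.X) :
    toDualEquiv W κ S₀ D x = D.toDual x :=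
  rfl

end Dual

end Summit.BirchSwinnertonDyer.Rank1Residual.X2.NonPrimitiveSelmerDual

end
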